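import Summits.QuantumFields.YangMills.Theorems.IR.RunningLandmarkDefs
import Summits.QuantumFields.YangMills.Theorems.BalabanLadderIRcofRunningLandmarkPinKit
import Summits.QuantumFields.YangMills.Theorems.BalabanLadderIRAfOnsetHalfSpace
import Summits.QuantumFields.YangMills.Theorems.BalabanLadderInfVolFloorsCore
import Summits.QuantumFields.YangMills.Theorems.BalabanLadderIRAfOnsetLargeUnit
import HarnessLib

/-!
# Crux `IRcof` (stmt-QuantumFields-26930) — LINE «running-landmark», helper (J) part 2∕2: THE JUNCTION LEMMA
# `pin_of_window : RunningWindow → HyperscalingEnvelope → PinnedThaw` (the floor pins a thaw) — PROVED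

Helper for `Summit.QuantumFields.YangMills.Theses.BalabanLadder.IRcof` (stmt-QuantumFields-26930; `--supports … --as helper`).
Census row 48, line «running-landmark» (ideator ym-ir-idea-24 g0, lens `recomb2`; workfile `Cruxes/IRcof/Lines/running_landmark.lean`
81d9d3aed4c37d82; vocabulary = `Theorems/IR/RunningLandmarkDefs.lean` p666269, VERBATIM the workfile's; kit =
`Theorems/BalabanLadderIRcofRunningLandmarkPinKit.lean`).  Critic ym-ir-crit-3 g3, `VERDICT-running-landmark-idea24-crit3-g3.md`
2026-08-28T20:34Z: PASS-WITH-PRICE, «LOCATED = the junction lemma (J) `stub_pin` (provable-looking; proof sketch below) … KEY (№34):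
ONE helper — prove (J) … the statement must be J's literal `RunningWindow → HyperscalingEnvelope → PinnedThaw` over the Lines file's
defs».  This file proves exactly that statement, over the landed defs, so that the workfile's `stub_pin` closes by
`exact pin_of_window` once it imports the Defs module (its §0–§1 copies deleted).

WHAT (J) SAYS.  (RW) `RunningWindow` [UV-class: on the `η₁`-frozen window the action-density covariance at lags `[n, 2n]` is
`≤ K/(n⁸ log² r_z(β,n))` for some nontrivial central twist ratio `r_z`] and (H) `HyperscalingEnvelope` [soft: `|Cov(x,x+w)|‖w‖⁸ ≤ C`]
imply `PinnedThaw`: for s.c. compact simple `G` with a nontrivial central twist, every `r`, every positive unit `a → 0` carrying the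
floor `LowerBounds G r a`, there are `η ∈ (0,1)`, `R`, `β₀` with: for every `β ≥ β₀` some cold box of half-side `ℓ` is `η`-THAWED
(`r_z(β, ℓ) ≥ η` for a nontrivial central `z`) with `a(β)·ℓ ≤ R` — the floor is consumed here and only here (honours
`IRcof_false_without_LowerBounds`, p630186).

PROOF = the critic's sketch, over parent family A's kit (`AfOnset.*`): see the docstring of `pin_of_window`; the summation engine
is `abs_doubleSum_le_budget` (§J3b).  No new definition, no named fact, no Yang–Mills content: Schwartz bookkeeping.

HONEST FRAMING: (J) is a junction between two OPEN statements (RW: constructive-UV content; H: open, soft) and the floor; it moves no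
wall — (EP) `PureWithinLandmark` carries the infrared content of the line (width 0, declared); width of this file toward PXcof ∕
`IRcof` ∕ `IR`: 0; nothing here proves confinement, a lattice gap, `IRcof`, `IR` or the Yang–Mills mass gap (Clay) — NOT proved;
R4 closes only the conditional finite-𝕋⁴ rung `BalabanLadder.UV`.
-/

set_option autoImplicit false

noncomputable section

open Filter Topology MeasureTheory Finset
open scoped BigOperators SchwartzMap
open Literature.MathematicalPhysics.QuantumFieldTheory hiding ZdEdge
open Literature.MathematicalPhysics.QuantumLattice
open Literature.Probability.LatticeModels (Site)
open Summit.QuantumFields.YangMills.Cruxes.OSLegsFromFemtoAndGap.DlrCollarTransfer (LowerBounds torusE dens Q2)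

namespace Summit.QuantumFields.YangMills.Cruxes.IRcof.RunningLandmark

/-! ## §J3b The summation engine -/

section Budget

open Literature.Probability.LatticeModels (box mem_box)

/-- **The summation engine.**  For `F` (vanishing on `{0 ≤ u 0}`) and `G` (vanishing on `{u 0 ≤ 0}`) with the cubic bound of
constant `Cᵥ`, a unit `0 < s ≤ 1`, a ball radius `N ≥ 0`, a far threshold `D > 0`, and a kernel `cov` on `X × X` bounded by `C₀`
everywhere, by `Wn (1+‖x−y‖)⁻⁸` on the in-ball NEAR pairs and by `Wf (1+‖x−y‖)⁻⁸` on the in-ball FAR pairs: if the three pieces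
are budgeted (`Wn·64Cᵥ²Z₃² ≤ ε/4`, the far piece `≤ ε/8`, the tail product `≤ ε/16`), then
`|Σ_{x,y ∈ X} F(s x) G(s y) cov(x,y)| ≤ ε/4 + ε/8 + ε/16 + ε/16` (`AfOnset.doubleSum_kernel8_le`, `doubleSum_kernel8_far_le`,
`sum_abs_smul_tail_le`, `sum_abs_smul_le`). -/
theorem abs_doubleSum_le_budget {F G : EuclideanSpace ℝ (Fin 4) → ℝ} {Cv : ℝ} (hCv : 0 ≤ Cv)
    (hF : ∀ u : EuclideanSpace ℝ (Fin 4), |F u| ≤ Cv * |u 0| ^ 3 / (1 + ‖u‖) ^ 10)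
    (hF0 : ∀ u : EuclideanSpace ℝ (Fin 4), 0 ≤ u 0 → F u = 0)
    (hG : ∀ u : EuclideanSpace ℝ (Fin 4), |G u| ≤ Cv * |u 0| ^ 3 / (1 + ‖u‖) ^ 10)
    (hG0 : ∀ u : EuclideanSpace ℝ (Fin 4), u 0 ≤ 0 → G u = 0)
    {s ε N Wn Wf C₀ D : ℝ} (hs : 0 < s) (hs1 : s ≤ 1) (hN : 0 ≤ N) (hD : 0 < D)
    (hWn : 0 ≤ Wn) (hWf : 0 ≤ Wf) (hC₀ : 0 ≤ C₀) (cov : Site 4 → Site 4 → ℝ) (X : Finset (Site 4))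
    (hcov : ∀ x ∈ X, ∀ y ∈ X, |cov x y| ≤ C₀)
    (hnear : ∀ x ∈ X, ∀ y ∈ X, ‖x‖ ≤ N → ‖y‖ ≤ N → ¬ D < s * ‖x - y‖ → |cov x y| ≤ Wn / (1 + ‖x - y‖) ^ 8)
    (hfar : ∀ x ∈ X, ∀ y ∈ X, ‖x‖ ≤ N → ‖y‖ ≤ N → D < s * ‖x - y‖ → |cov x y| ≤ Wf / (1 + ‖x - y‖) ^ 8)
    (h1 : Wn * (64 * Cv ^ 2 * (3 ^ 3 * ∑' k : ℕ, (((k : ℝ) + 1) ^ 2)⁻¹) ^ 2) ≤ ε / 4)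
    (h2 : Wf * (64 * Cv ^ 2 * (3 ^ 3 * ∑' k : ℕ, (((k : ℝ) + 1) ^ 2)⁻¹) ^ 2 * s ^ 3 / (s ^ 3 * D)) ≤ ε / 8)
    (h3 : C₀ * (Cv * (3 ^ 4 * ∑' k : ℕ, (((k : ℝ) + 1) ^ 2)⁻¹) / ((1 + s * N) * s ^ 4)) *
      (Cv * (3 ^ 4 * ∑' k : ℕ, (((k : ℝ) + 1) ^ 2)⁻¹) / s ^ 4) ≤ ε / 16) :
    |∑ x ∈ X, ∑ y ∈ X, F (s • siteToE x) * G (s • siteToE y) * cov x y| ≤ ε / 4 + ε / 8 + ε / 16 + ε / 16 := by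
  have hmin : min s 1 = s := min_eq_left hs1
  have hsplit := abs_doubleSum_le_split (F := F) (G := G) cov (s := s) (N := N) hWn hWf hC₀ X X hcov hnear hfar
  -- piece 1: the near class (kernel sum uniform in the unit)
  have hk8 := Summit.QuantumFields.YangMills.Cruxes.IR.AfOnset.doubleSum_kernel8_le hCv hF hF0 hG hG0 hs X X
  rw [hmin, div_self hs.ne', one_pow, mul_one] at hk8
  have hP1 := mul_le_mul_of_nonneg_left hk8 hWn
  -- piece 2: the far class
  have hkf := Summit.QuantumFields.YangMills.Cruxes.IR.AfOnset.doubleSum_kernel8_far_le hCv hF hF0 hG hG0 hs hD X X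
  rw [hmin] at hkf
  have hP2 := mul_le_mul_of_nonneg_left hkf hWf
  -- pieces 3, 4: the tails
  have hfullF := Summit.QuantumFields.YangMills.Cruxes.IR.AfOnset.sum_abs_smul_le hCv hF hs X
  have hfullG := Summit.QuantumFields.YangMills.Cruxes.IR.AfOnset.sum_abs_smul_le hCv hG hs X
  have htailF := Summit.QuantumFields.YangMills.Cruxes.IR.AfOnset.sum_abs_smul_tail_le hCv hF hs hN X
  have htailG := Summit.QuantumFields.YangMills.Cruxes.IR.AfOnset.sum_abs_smul_tail_le hCv hG hs hN X
  rw [hmin] at hfullF hfullG htailF htailG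
  have hP3 : C₀ * ∑ x ∈ X, ∑ y ∈ X, (if N < ‖x‖ then |F (s • siteToE x)| * |G (s • siteToE y)| else 0) ≤ ε / 16 := by
    rw [sum_sum_ite_norm_fst]
    refine (mul_le_mul_of_nonneg_left (mul_le_mul htailF hfullG (Finset.sum_nonneg fun _ _ => abs_nonneg _)
      (by positivity)) hC₀).trans ?_
    rw [← mul_assoc]; exact h3
  have hP4 : C₀ * ∑ x ∈ X, ∑ y ∈ X, (if N < ‖y‖ then |F (s • siteToE x)| * |G (s • siteToE y)| else 0) ≤ ε / 16 := by
    rw [sum_sum_ite_norm_snd]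
    refine (mul_le_mul_of_nonneg_left (mul_le_mul hfullF htailG (Finset.sum_nonneg fun _ _ => abs_nonneg _)
      (by positivity)) hC₀).trans ?_
    calc C₀ * (Cv * (3 ^ 4 * ∑' k : ℕ, (((k : ℝ) + 1) ^ 2)⁻¹) / s ^ 4 *
          (Cv * (3 ^ 4 * ∑' k : ℕ, (((k : ℝ) + 1) ^ 2)⁻¹) / ((1 + s * N) * s ^ 4)))
        = C₀ * (Cv * (3 ^ 4 * ∑' k : ℕ, (((k : ℝ) + 1) ^ 2)⁻¹) / ((1 + s * N) * s ^ 4)) *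
          (Cv * (3 ^ 4 * ∑' k : ℕ, (((k : ℝ) + 1) ^ 2)⁻¹) / s ^ 4) := by ring
      _ ≤ ε / 16 := h3
  linarith [hP1.trans h1, hP2.trans h2]

end Budget

/-! ## §J4 The junction lemma (J): `RunningWindow → HyperscalingEnvelope → PinnedThaw` -/

section Junction

open Literature.Probability.LatticeModels (box mem_box)
open Summit.QuantumFields.YangMills.Cruxes.IR.AfOnset
open Summit.QuantumFields.YangMills.Theorems.InfiniteVolume (exists_abs_dens_le_uniform abs_torusCov_dens_le)

/-- **(J) THE JUNCTION LEMMA `pin_of_window` — the floor pins a thaw** (census row 48, the line's ONE new lemma; critic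
ym-ir-crit-3 g3: «LOCATED … provable-looking», KEY (№34) = this helper).  Assume (RW) `RunningWindow` and (H)
`HyperscalingEnvelope`.  Then `PinnedThaw`: for s.c. compact simple `G` with a nontrivial central twist, every `r`, every positive
unit `a → 0` carrying the floor `LowerBounds G r a`, there are `η ∈ (0,1)`, `R`, `β₀` such that for every `β ≥ β₀` some cold box of
half-side `ℓ` is `η`-thawed with `a(β)·ℓ ≤ R`.

Proof (Schwartz bookkeeping over parent family A; NO Yang–Mills content).  Take the floor's `(v, ε, β₅, Λ₅)`:
`ε ≤ Q2(β, L, a(β), θv, v) = Σ_{x,y ∈ box L} θv(a x) v(a y) Cov_{β,L}(x,y)` for all large `β` and all `L ≥ Λ₅/a`.  Constants: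
`J = 64 Cᵥ² Z₃² + 1` (`Cᵥ` the cubic-vanishing constant of `v, θv` at the time-zero plane, `AfOnset.exists_abs_*_le_cube_div`),
`W_f = 2⁸ max(C_H,0)`, `D = 8 W_f J/ε + 8`, `t = √(8·4⁸KJ/ε) + 1`, `η⋆ = min(η₁, e^{−t})`, `R = D + 1`.  Fix `β` large
(`a = a(β) ≤ 1`).  DICHOTOMY on the half-sides `ℓ ≤ n_D = ⌈D/a⌉`: if one is `η⋆`-thawed we are done (`a·ℓ ≤ D + a ≤ D + 1`).
Otherwise `FrozenBelow(β, η⋆, n_D)`, and we bound `Q2 ≤ ε/2 < ε` at ONE admissible torus size `L`, a contradiction.  Termwise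
(`abs_doubleSum_le_split`): pairs with `‖x‖, ‖y‖ ≤ Nₙ` (`Nₙ ≍ a⁻⁹`) and `a‖x−y‖ ≤ D` are SHORT (`‖y−x‖₂ < 8`:
`|Cov| ≤ W₁(1+log β)²/β²`, parent A `AfOnset.exists_abs_torusCov_dens_le`) or in the WINDOW (`8 ≤ ‖y−x‖₂ ≤ 2n_D`: (RW) at the
shell `n` of `exists_shell` — frozen at `η₁ ≥ η⋆` — gives `|Cov| n⁸ ≤ K/log² r_z(β,n)` with `r_z(β,n) < η⋆ ≤ e^{−t}`, so
`|Cov| ≤ 4⁸(K/t²)(1+‖x−y‖)⁻⁸`, `cov_window_bound`); pairs in the ball with `D < a‖x−y‖` are FAR ((H): `cov_far_bound`); pairs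
outside the ball use `|Cov| ≤ 2C_d²`.  Summing (`abs_doubleSum_le_budget`): the near class by `AfOnset.doubleSum_kernel8_le` (the
`a⁻⁸` pairs against the cubic vanishing: `≤ (W_s + W_w)·J ≤ ε/8 + ε/8`), the far class by `doubleSum_kernel8_far_le` (`≤ ε/8`), the
tails by `sum_abs_smul_tail_le` × `sum_abs_smul_le` (`≤ ε/16 + ε/16`).  Only FINITELY many lags `w` and shells `n` occur at each `β`,
so (H)'s per-`w` and (RW)'s per-`n` torus thresholds are met at one `L ≥ Λ₅/a` (`exists_torus_size`). -/
theorem pin_of_window : RunningWindow → HyperscalingEnvelope → PinnedThaw := by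
  intro hRWall hHall G _ _ _ _ hG hsc hz
  letI : MeasurableSpace G := borel G
  haveI : BorelSpace G := ⟨rfl⟩
  intro r a ha ha0 hlb
  haveI : SecondCountableTopology G :=
    (r.continuous.isClosedEmbedding r.injective).isEmbedding.secondCountableTopology
  classical
  -- `‖z‖₂ ≤ 2 ‖z‖_∞` on `ℤ⁴` (the tree's `StrongCouplingIRTrivial.norm_siteToE_le`, re-derived locally to keep the import cone
  -- free of foreign route files)
  have hE2 : ∀ z : Site 4, ‖siteToE z‖ ≤ 2 * ‖z‖ := fun z => by
    rw [EuclideanSpace.norm_eq]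
    have hle : ∀ i : Fin 4, ‖siteToE z i‖ ^ 2 ≤ ‖z‖ ^ 2 := fun i => by
      have h1 : ‖siteToE z i‖ = ‖z i‖ := by rw [siteToE_apply, Real.norm_eq_abs, Int.norm_eq_abs]
      rw [h1]
      exact pow_le_pow_left₀ (norm_nonneg _) (norm_le_pi_norm z i) 2
    have hsum : ∑ i : Fin 4, ‖siteToE z i‖ ^ 2 ≤ (2 * ‖z‖) ^ 2 := by
      calc ∑ i : Fin 4, ‖siteToE z i‖ ^ 2 ≤ ∑ _i : Fin 4, ‖z‖ ^ 2 := Finset.sum_le_sum fun i _ => hle i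
        _ = (2 * ‖z‖) ^ 2 := by simp; ring
    calc Real.sqrt (∑ i : Fin 4, ‖siteToE z i‖ ^ 2) ≤ Real.sqrt ((2 * ‖z‖) ^ 2) := Real.sqrt_le_sqrt hsum
      _ = 2 * ‖z‖ := Real.sqrt_sq (by positivity)
  -- the hypotheses at `(G, r)` and the floor
  obtain ⟨K, η₁, βR, hK, hη₁0, hη₁1, hRW⟩ := hRWall G hG hsc hz r
  obtain ⟨CH, βH, hH⟩ := hHall G hG hsc r
  obtain ⟨⟨v, ε, β₅, Λ₅, hv, hε, hfloor⟩, -⟩ := hlb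
  -- constants of parent family A
  obtain ⟨Cd, hCd0, hCd⟩ := exists_abs_dens_le_uniform (G := G) r
  obtain ⟨W₁, hW₁0, hW₁⟩ := exists_abs_torusCov_dens_le (G := G) (r := r)
  obtain ⟨C₁, hC₁0, hC₁⟩ := exists_abs_thetaTest_le_cube_div v hv
  obtain ⟨C₂, hC₂0, hC₂⟩ := exists_abs_le_cube_div_of_tsupport v hv
  obtain ⟨Cv, hCv⟩ : ∃ Cv : ℝ, Cv = max C₁ C₂ := ⟨_, rfl⟩
  have hCv0 : 0 ≤ Cv := by rw [hCv]; exact hC₁0.trans (le_max_left _ _)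
  have hC₁v : C₁ ≤ Cv := by rw [hCv]; exact le_max_left _ _
  have hC₂v : C₂ ≤ Cv := by rw [hCv]; exact le_max_right _ _
  have hθv : ∀ u : EuclideanSpace ℝ (Fin 4), |thetaTest 4 v u| ≤ Cv * |u 0| ^ 3 / (1 + ‖u‖) ^ 10 := fun u =>
    (hC₁ u).trans (div_le_div_of_nonneg_right (mul_le_mul_of_nonneg_right hC₁v (by positivity)) (by positivity))
  have hvv : ∀ u : EuclideanSpace ℝ (Fin 4), |v u| ≤ Cv * |u 0| ^ 3 / (1 + ‖u‖) ^ 10 := fun u =>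
    (hC₂ u).trans (div_le_div_of_nonneg_right (mul_le_mul_of_nonneg_right hC₂v (by positivity)) (by positivity))
  have hθv0 : ∀ u : EuclideanSpace ℝ (Fin 4), 0 ≤ u 0 → thetaTest 4 v u = 0 :=
    thetaTest_apply_eq_zero_of_tsupport_subset v hv
  have hv0 : ∀ u : EuclideanSpace ℝ (Fin 4), u 0 ≤ 0 → v u = 0 := apply_eq_zero_of_tsupport_subset v hv
  -- the line's constants (`Z₃ = 27 Σ(k+1)⁻²`, `Z₄ = 81 Σ(k+1)⁻²`)
  obtain ⟨Q, hQ⟩ : ∃ Q : ℝ, Q = 64 * Cv ^ 2 * (3 ^ 3 * ∑' k : ℕ, (((k : ℝ) + 1) ^ 2)⁻¹) ^ 2 := ⟨_, rfl⟩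
  have hQ0 : 0 ≤ Q := by rw [hQ]; positivity
  obtain ⟨J, hJ⟩ : ∃ J : ℝ, J = Q + 1 := ⟨_, rfl⟩
  have hQJ : Q ≤ J := by rw [hJ]; linarith
  have hJ0 : 0 < J := by rw [hJ]; linarith
  obtain ⟨C₀, hC₀⟩ : ∃ C₀ : ℝ, C₀ = 2 * Cd ^ 2 := ⟨_, rfl⟩
  have hC₀0 : 0 ≤ C₀ := by rw [hC₀]; positivity
  obtain ⟨Wf, hWf⟩ : ∃ Wf : ℝ, Wf = 2 ^ 8 * max CH 0 := ⟨_, rfl⟩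
  have hWf0 : 0 ≤ Wf := by rw [hWf]; positivity
  obtain ⟨D, hD⟩ : ∃ D : ℝ, D = 8 * (Wf * J) / ε + 8 := ⟨_, rfl⟩
  have hD8 : 8 ≤ D := by
    have h0 : 0 ≤ 8 * (Wf * J) / ε := by positivity
    rw [hD]; linarith
  have hD0 : 0 < D := by linarith
  obtain ⟨t, ht⟩ : ∃ t : ℝ, t = Real.sqrt (8 * (4 ^ 8 * K * J) / ε) + 1 := ⟨_, rfl⟩
  have ht0 : 0 < t := by rw [ht]; positivity
  have ht2 : 8 * (4 ^ 8 * K * J) / ε ≤ t ^ 2 := by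
    have h1 : Real.sqrt (8 * (4 ^ 8 * K * J) / ε) ^ 2 = 8 * (4 ^ 8 * K * J) / ε := Real.sq_sqrt (by positivity)
    rw [← h1, ht]
    exact pow_le_pow_left₀ (Real.sqrt_nonneg _) (by linarith) 2
  obtain ⟨ηs, hηs⟩ : ∃ ηs : ℝ, ηs = min η₁ (Real.exp (-t)) := ⟨_, rfl⟩
  have hηs0 : 0 < ηs := by rw [hηs]; exact lt_min hη₁0 (Real.exp_pos _)
  have hηs1 : ηs < 1 := by rw [hηs]; exact (min_le_left _ _).trans_lt hη₁1
  have hηsη₁ : ηs ≤ η₁ := by rw [hηs]; exact min_le_left _ _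
  have hηst : ηs ≤ Real.exp (-t) := by rw [hηs]; exact min_le_right _ _
  obtain ⟨T₀, hT₀⟩ : ∃ T₀ : ℝ, T₀ = 16 * (C₀ * Cv ^ 2 * (3 ^ 4 * ∑' k : ℕ, (((k : ℝ) + 1) ^ 2)⁻¹) ^ 2) / ε + 1 :=
    ⟨_, rfl⟩
  have hT₀0 : 0 < T₀ := by rw [hT₀]; positivity
  -- the unit is eventually `≤ 1`
  obtain ⟨βa, hβa⟩ : ∃ βa : ℝ, ∀ β, βa ≤ β → a β ≤ 1 :=
    eventually_atTop.1 (ha0.eventually (eventually_le_nhds one_pos))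
  -- the threshold
  refine ⟨ηs, D + 1, max (max (max (max β₅ βR) (max βH 1)) βa) (32 * (9 ^ 8 * W₁ * J) / ε + 1), hηs0, hηs1,
    fun β hβ => ?_⟩
  have hβ5 : β₅ ≤ β := le_trans (by simp) hβ
  have hβR : βR ≤ β := le_trans (by simp) hβ
  have hβH : βH ≤ β := le_trans (by simp) hβ
  have hβ1 : 1 ≤ β := le_trans (by simp) hβ
  have hβa' : a β ≤ 1 := hβa β (le_trans (by simp) hβ)
  have hβs' : 32 * (9 ^ 8 * W₁ * J) / ε + 1 ≤ β := le_trans (le_max_right _ _) hβ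
  have hs : 0 < a β := ha β
  -- the dyadic range and the dichotomy
  obtain ⟨nD, hnD⟩ : ∃ nD : ℕ, nD = ⌈D / a β⌉₊ := ⟨_, rfl⟩
  have hnD_ge : D / a β ≤ nD := by rw [hnD]; exact Nat.le_ceil _
  have hDs : D ≤ D / a β := by
    rw [le_div_iff₀ hs]; nlinarith
  have hnD8 : 8 ≤ nD := by
    have h := Nat.ceil_mono (show ((8 : ℕ) : ℝ) ≤ D / a β by exact_mod_cast hD8.trans hDs)
    rwa [Nat.ceil_natCast, ← hnD] at h
  by_contra hcon
  have hfz : FrozenBelow r.ρ β ηs nD := by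
    intro ℓ hℓ hth
    refine hcon ⟨ℓ, hth, ?_⟩
    have h1 : (ℓ : ℝ) ≤ nD := by exact_mod_cast hℓ
    have h2 : ((nD : ℕ) : ℝ) ≤ D / a β + 1 := by rw [hnD]; exact (Nat.ceil_lt_add_one (by positivity)).le
    have h3 : a β * (D / a β + 1) = D + a β := by field_simp
    calc a β * (ℓ : ℝ) ≤ a β * nD := mul_le_mul_of_nonneg_left h1 hs.le
      _ ≤ a β * (D / a β + 1) := mul_le_mul_of_nonneg_left h2 hs.le
      _ = D + a β := h3
      _ ≤ D + 1 := by linarith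
  -- torus thresholds of (RW) on the dyadic range and of (H) on the lags of the ball
  have hRWn : ∀ n : ℕ, ∃ S₀ : ℕ, 8 ≤ n → n ≤ nD → ∀ S : ℕ, S₀ ≤ S → ∀ x y : Site 4,
      (n : ℝ) ≤ ‖siteToE (y - x)‖ → ‖siteToE (y - x)‖ ≤ 2 * n →
        ∃ z : Fin 4 → G, IsCentralTwist z ∧
          |torusCov G r β S x y| * (n : ℝ) ^ 8 ≤ K / Real.log (twistRatio r.ρ β z n) ^ 2 := by
    intro n
    by_cases hn : 8 ≤ n ∧ n ≤ nD
    · obtain ⟨S₀, hS₀⟩ := hRW β hβR n hn.1 (frozenBelow_mono hηsη₁ hn.2 hfz)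
      exact ⟨S₀, fun _ _ => hS₀⟩
    · exact ⟨0, fun h8 hle => absurd ⟨h8, hle⟩ hn⟩
  choose SR hSR using hRWn
  have hHw : ∀ w : Site 4, ∃ S₀ : ℕ, w ≠ 0 → ∀ S : ℕ, S₀ ≤ S → ∀ x : Site 4,
      |torusCov G r β S x (x + w)| * ‖siteToE w‖ ^ 8 ≤ CH := by
    intro w
    by_cases hw : w = 0
    · exact ⟨0, fun h => absurd hw h⟩
    · obtain ⟨S₀, hS₀⟩ := hH β hβH w hw
      exact ⟨S₀, fun _ => hS₀⟩
  choose SH hSH using hHw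
  -- the ball radius and the torus size
  obtain ⟨Nn, hNndef⟩ : ∃ Nn : ℕ, Nn = ⌈T₀ / a β ^ 9⌉₊ := ⟨_, rfl⟩
  have hNn : T₀ / a β ^ 9 ≤ Nn := by rw [hNndef]; exact Nat.le_ceil _
  have hNn0 : (0 : ℝ) ≤ Nn := Nat.cast_nonneg _
  obtain ⟨L, hL1, hLΛ, hLR, hLH⟩ := exists_torus_size SR SH hs Λ₅ nD Nn
  -- the floor at `(β, L)`
  have hfl : ε ≤ Q2 G r β L (a β) (thetaTest 4 v) v := hfloor β hβ5 L hLΛ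
  -- the covariance bounds: trivial, near (short + window), far
  have hcovC₀ : ∀ x y : Site 4, |torusCov G r β L x y| ≤ C₀ := fun x y => by
    rw [hC₀]; exact abs_torusCov_dens_le r hCd0 hCd β L x y
  obtain ⟨Ws, hWs⟩ : ∃ Ws : ℝ, Ws = 9 ^ 8 * (W₁ * (1 + Real.log β) ^ 2 / β ^ 2) := ⟨_, rfl⟩
  have hWs0 : 0 ≤ Ws := by rw [hWs]; positivity
  obtain ⟨Ww, hWw⟩ : ∃ Ww : ℝ, Ww = 4 ^ 8 * (K / t ^ 2) := ⟨_, rfl⟩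
  have hWw0 : 0 ≤ Ww := by rw [hWw]; positivity
  have hnear : ∀ x y : Site 4, ‖x‖ ≤ (Nn : ℝ) → ‖y‖ ≤ (Nn : ℝ) → ¬ D < a β * ‖x - y‖ →
      |torusCov G r β L x y| ≤ (Ws + Ww) / (1 + ‖x - y‖) ^ 8 := by
    intro x y _ _ hDxy
    rw [not_lt] at hDxy
    have hxy : ‖x - y‖ = ‖y - x‖ := norm_sub_rev x y
    have hk0 : 0 < (1 + ‖x - y‖) ^ 8 := by positivity
    by_cases h8 : ‖siteToE (y - x)‖ < 8
    · -- SHORT lags: parent A's `O(log² β/β²)` bound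
      have h1 : |torusCov G r β L x y| ≤ W₁ * (1 + Real.log β) ^ 2 / β ^ 2 := hW₁ L hL1 β hβ1 x y
      have h2 := le_div_pow_of_norm_lt (w := y - x) (by positivity : 0 ≤ W₁ * (1 + Real.log β) ^ 2 / β ^ 2) h8
      rw [← hxy, ← hWs] at h2
      exact (h1.trans h2).trans (div_le_div_of_nonneg_right (le_add_of_nonneg_right hWw0) hk0.le)
    · -- WINDOW: (RW) at the dyadic shell of the lag, frozen at `η⋆`
      rw [not_lt] at h8
      have hw0 : y - x ≠ 0 := by
        intro h; rw [h, Summit.QuantumFields.YangMills.Cruxes.IR.AfOnset.siteToE_zero, norm_zero] at h8; linarith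
      obtain ⟨n, hn8, hn_le, hn_ge, hn_min⟩ := exists_shell h8
      have hn_nD : n ≤ nD := by
        refine hn_min nD hnD8 (le_trans ?_ hnD_ge)
        have h1 := hE2 (y - x)
        have h2 : ‖x - y‖ ≤ D / a β := by rw [le_div_iff₀ hs, mul_comm]; exact hDxy
        rw [← hxy] at h1
        linarith
      obtain ⟨z, hz, hb⟩ := hSR n hn8 hn_nD L (hLR n hn8 hn_nD) x y hn_le hn_ge
      have hrlt : twistRatio r.ρ β z n < ηs := by
        by_contra h
        exact hfz n hn_nD ⟨hn8, z, hz, not_lt.1 h⟩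
      have h2 := cov_window_bound hw0 hK ht0 (lt_of_lt_of_le (by norm_num) hn8) (twistRatio_pos r.continuous β z n)
        (hrlt.trans_le hηst) hn_ge hb
      rw [← hxy, ← hWw] at h2
      exact h2.trans (div_le_div_of_nonneg_right (le_add_of_nonneg_left hWs0) hk0.le)
  have hfar : ∀ x y : Site 4, ‖x‖ ≤ (Nn : ℝ) → ‖y‖ ≤ (Nn : ℝ) → D < a β * ‖x - y‖ →
      |torusCov G r β L x y| ≤ Wf / (1 + ‖x - y‖) ^ 8 := by
    intro x y hx hy hDxy
    have hxy : ‖x - y‖ = ‖y - x‖ := norm_sub_rev x y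
    have hw0 : y - x ≠ 0 := by
      intro h
      have h0 : ‖x - y‖ = 0 := by rw [hxy, h, norm_zero]
      rw [h0, mul_zero] at hDxy
      linarith
    have hwbox : y - x ∈ box 4 (2 * Nn) := by
      refine mem_box_of_norm_le ?_
      calc ‖y - x‖ ≤ ‖y‖ + ‖x‖ := norm_sub_le y x
        _ ≤ Nn + Nn := add_le_add hy hx
        _ = ((2 * Nn : ℕ) : ℝ) := by push_cast; ring
    have hb := hSH (y - x) hw0 L (hLH _ hwbox) x
    rw [add_sub_cancel] at hb
    have h2 := cov_far_bound hw0 hb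
    rw [← hxy, ← hWf] at h2
    exact h2
  -- the budget of the three pieces
  have h1 : (Ws + Ww) * Q ≤ ε / 4 := by
    have hWsJ : Ws * J ≤ ε / 8 := by rw [hWs]; exact short_piece_le hW₁0 hJ0 hε hβ1 hβs'
    have hWwJ : Ww * J ≤ ε / 8 := by rw [hWw]; exact window_piece_le hε ht0 ht2
    have hA : Ws * Q ≤ Ws * J := mul_le_mul_of_nonneg_left hQJ hWs0
    have hB : Ww * Q ≤ Ww * J := mul_le_mul_of_nonneg_left hQJ hWw0
    linarith
  have h2 : Wf * (Q * a β ^ 3 / (a β ^ 3 * D)) ≤ ε / 8 := far_piece_le' hWf0 hε hs hQ0 hQJ hD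
  have h3 := tails_piece_le (Cv := Cv) (Z₄ := 3 ^ 4 * ∑' k : ℕ, (((k : ℝ) + 1) ^ 2)⁻¹) hC₀0 hε hs hNn0 hT₀ hNn
  rw [hQ] at h1 h2
  have hsum := abs_doubleSum_le_budget hCv0 hθv hθv0 hvv hv0 hs hβa' hNn0 hD0 (add_nonneg hWs0 hWw0) hWf0 hC₀0
    (torusCov G r β L) (box 4 L) (fun x _ y _ => hcovC₀ x y) (fun x _ y _ => hnear x y) (fun x _ y _ => hfar x y)
    h1 h2 h3
  -- contradiction with the floor
  have hQ2 : Q2 G r β L (a β) (thetaTest 4 v) v ≤ ε / 4 + ε / 8 + ε / 16 + ε / 16 := by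
    rw [Q2_eq_sum_torusCov]
    exact (le_abs_self _).trans hsum
  linarith

end Junction

end Summit.QuantumFields.YangMills.Cruxes.IRcof.RunningLandmark

end
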